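import Literature.NumberTheory.Automorphic.InfUnitaryHilbertCompletion   -- ★ G0 (A-p14 (g24)): `IsPosDefHerm`, `.nacg`, `.ips` (pre-Hilbert structure of `(V, B)` as terms)
import Literature.Analysis.OperatorTheory.SkewIntegerSpectrumBound       -- ★ p833857 (A-p06 (g24)): T1 `form_eq_zero_of_skew_eigen` (orthogonality of eigenvectors)
import Mathlib.Analysis.InnerProductSpace.Spectrum
import Mathlib.LinearAlgebra.Lagrange
import HarnessLib

/-!
# The spectrum of a skew operator on a finite-dimensional positive-definite Hermitian space: real nodes, annihilation, and the resulting bound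

Topic `NumberTheory/Automorphic` (home of ★ `IsPosDefHerm`); namespace `Literature.NumberTheory.Automorphic`; THEOREMS ONLY (no `def`, no named fact, no instance,
no notation, no `sorry`).  Cell `hodgecm-mathlib`, F0∕P3, T1a arch line, ROAD-GLOB (A6 #92 at `U(2,1)`), brick «FB», piece **T3** (BASE CASE of the torus
bound, A-p06 (g24) plan 2026-08-31): for the `IsInfUnitary` form `B` (positive definite Hermitian, ★ G0) and a `B`-skew operator `D` (e.g. `ρ𝔤(torusGen a b)`)
preserving a finite-dimensional subspace `W₀` (the generating `K`-type):
* **`exists_nodal_real_annihilates_of_skew`** — there is a finite set of REAL nodes `S₀ ⊂ [−r₀, r₀]` with `∏_{x∈S₀} (D − i x) = 0` on `W₀`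
  (`D|_{W₀}` is normal: `−i D|_{W₀}` is symmetric for the pre-Hilbert structure ★ `IsPosDefHerm.ips`, Mathlib's spectral theorem gives an orthonormal
  eigenbasis with real eigenvalues — NO integrality of weights is needed) = the hypothesis `hW₀` of ★ T2 `upqPFiltration_le_ker_aeval_nodal_torusGen` (v2);
* **`re_form_apply_apply_le_of_skew_of_nodal_real`** — the real-node twin of ★ T1 `re_form_apply_apply_le_of_skew_of_nodal`: `(∏_{x∈S}(D − i x)) u = 0`,
  `|x| ≤ r` on `S` ⇒ `Re B (D u) (D u) ≤ r² Re B u u` (same Lagrange proof) = what T2's conclusion feeds at level `n` with `r = r₀ + n`.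
HONEST LABEL: closes no registered stub by itself.  HC_CM is proved only modulo the 2 remaining named inputs (hLiu418, h413) until rung 0 closes.

## References
* Harish-Chandra, *Representations of a semisimple Lie group on a Banach space. I*, Trans. AMS 75 (1953), §9 [HarishChandra1953].
* A. Borel, *Automorphic forms on `SL₂(ℝ)`* (1997), Thm. 8.5 [Borel1997].
* A. W. Knapp, D. A. Vogan, *Cohomological Induction and Unitary Representations* (1995), Introduction (0.5) [KnappVogan1995].
-/

set_option autoImplicit false

noncomputable section

namespace Literature.NumberTheory.Automorphic

open Polynomial Finset
open scoped ComplexConjugate InnerProductSpace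

universe u

variable {V : Type u} [AddCommGroup V] [Module ℂ V]

/-! ## §1 The real-node bound (twin of ★ T1) -/

/-- **Real-node twin of ★ T1.**  `B` with `Re B x x ≥ 0`, `D` `B`-skew, `(∏_{x∈S} (D − i x)) u = 0` with `S ⊂ ℝ` finite, `|x| ≤ r` on `S`
⇒ `Re B (D u) (D u) ≤ r² · Re B u u`. [cite: HarishChandra1953, §9] [cite: Borel1997, Theorem 8.5] -/
theorem re_form_apply_apply_le_of_skew_of_nodal_real (B : V →ₗ⋆[ℂ] V →ₗ[ℂ] ℂ) (hpos : ∀ x, 0 ≤ (B x x).re)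
    (D : Module.End ℂ V) (hD : ∀ x y, B (D x) y = -B x (D y)) (S : Finset ℝ) (r : ℝ) (hSr : ∀ x ∈ S, |x| ≤ r) {u : V}
    (hu : aeval D (Lagrange.nodal S fun x : ℝ => (x : ℂ) * Complex.I) u = 0) :
    (B (D u) (D u)).re ≤ r ^ 2 * (B u u).re := by
  classical
  rcases S.eq_empty_or_nonempty with hS | hS
  · subst hS
    rw [Lagrange.nodal_empty, map_one, Module.End.one_apply] at hu
    subst hu
    simp
  set v : ℝ → ℂ := fun x => (x : ℂ) * Complex.I with hv
  have hinj : Set.InjOn v (S : Set ℝ) := by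
    intro a _ b _ h
    exact_mod_cast mul_right_cancel₀ Complex.I_ne_zero h
  set x : ℝ → V := fun k => aeval D (Lagrange.basis S v k) u with hx
  have hsum : ∑ k ∈ S, x k = u := by
    rw [hx]
    simp only []
    rw [← LinearMap.sum_apply, ← map_sum, Lagrange.sum_basis hinj hS, map_one, Module.End.one_apply]
  have heig : ∀ k ∈ S, D (x k) = v k • x k := by
    intro k hk
    have hfac : (X - Polynomial.C (v k)) * Lagrange.basis S v k = Polynomial.C (Lagrange.nodalWeight S v k) * Lagrange.nodal S v := by
      rw [Lagrange.basis_eq_prod_sub_inv_mul_nodal_div hk, ← Lagrange.nodal_erase_eq_nodal_div hk, mul_left_comm,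
        ← Lagrange.nodal_eq_mul_nodal_erase hk]
    have h1 : aeval D ((X - Polynomial.C (v k)) * Lagrange.basis S v k) u = 0 := by
      rw [hfac, map_mul, Module.End.mul_apply, hu, map_zero]
    rw [map_mul, Module.End.mul_apply, map_sub, aeval_X, aeval_C, LinearMap.sub_apply, sub_eq_zero, Module.algebraMap_end_apply] at h1
    exact h1
  have horth : ∀ k ∈ S, ∀ l ∈ S, k ≠ l → B (x k) (x l) = 0 := fun k hk l hl hkl =>
    Literature.Analysis.OperatorTheory.form_eq_zero_of_skew_eigen B D hD hkl (heig k hk) (heig l hl)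
  have hDu : D u = ∑ k ∈ S, v k • x k := by
    rw [← hsum, map_sum]
    exact Finset.sum_congr rfl fun k hk => heig k hk
  have hpyth : ∀ y : ℝ → V, (∀ k ∈ S, ∀ l ∈ S, k ≠ l → B (y k) (y l) = 0) → B (∑ k ∈ S, y k) (∑ l ∈ S, y l) = ∑ k ∈ S, B (y k) (y k) := by
    intro y hy
    rw [LinearMap.map_sum₂]
    refine Finset.sum_congr rfl fun k hk => ?_
    rw [map_sum]
    exact Finset.sum_eq_single_of_mem k hk fun l hl hlk => hy k hk l hl (Ne.symm hlk)
  have horth' : ∀ k ∈ S, ∀ l ∈ S, k ≠ l → B (v k • x k) (v l • x l) = 0 := by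
    intro k hk l hl hkl
    rw [LinearMap.map_smulₛₗ₂, LinearMap.map_smul, horth k hk l hl hkl, smul_zero, smul_zero]
  have h1 : B (D u) (D u) = ∑ k ∈ S, B (v k • x k) (v k • x k) := by rw [hDu]; exact hpyth _ horth'
  have h2 : B u u = ∑ k ∈ S, B (x k) (x k) := by conv_lhs => rw [← hsum]; exact hpyth x horth
  have hterm : ∀ k ∈ S, (B (v k • x k) (v k • x k)).re ≤ r ^ 2 * (B (x k) (x k)).re := by
    intro k hk
    rw [LinearMap.map_smulₛₗ₂, LinearMap.map_smul, smul_eq_mul, smul_eq_mul]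
    have hc : (starRingEnd ℂ) (v k) * (v k * B (x k) (x k)) = ((k : ℂ) ^ 2) * B (x k) (x k) := by
      rw [hv]
      simp only [map_mul, Complex.conj_I, Complex.conj_ofReal]
      ring_nf
      rw [Complex.I_sq]
      ring
    rw [hc]
    have hre : (((k : ℂ) ^ 2) * B (x k) (x k)).re = (k ^ 2) * (B (x k) (x k)).re := by
      have : ((k : ℂ) ^ 2) = ((k ^ 2 : ℝ) : ℂ) := by push_cast; ring
      rw [this, Complex.re_ofReal_mul]
    rw [hre]
    have hk2 : k ^ 2 ≤ r ^ 2 := by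
      calc k ^ 2 = |k| ^ 2 := (sq_abs _).symm
        _ ≤ r ^ 2 := pow_le_pow_left₀ (abs_nonneg _) (hSr k hk) 2
    exact mul_le_mul_of_nonneg_right hk2 (hpos _)
  rw [h1, h2, Complex.re_sum, Complex.re_sum, Finset.mul_sum]
  exact Finset.sum_le_sum hterm

/-! ## §2 The base case: real nodes annihilating a finite-dimensional `D`-stable subspace -/

/-- **T3 — BASE CASE.**  `B` positive definite Hermitian (★ `IsPosDefHerm`), `D` `B`-skew and preserving the finite-dimensional `W₀`: there are finitely many
REAL nodes `S₀`, all of absolute value `≤ r₀`, with `∏_{x∈S₀} (D − i x) = 0` on `W₀` (the eigenvalues of the symmetric operator `−i D|_{W₀}` for the pre-Hilbert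
structure `⟪x, y⟫ = B x y`; Mathlib's spectral theorem). [cite: Borel1997, Theorem 8.5] [cite: KnappVogan1995, Introduction (0.5)] -/
theorem exists_nodal_real_annihilates_of_skew {B : V →ₗ⋆[ℂ] V →ₗ[ℂ] ℂ} (hB : IsPosDefHerm B) (D : Module.End ℂ V)
    (hD : ∀ x y, B (D x) y = -B x (D y)) (W₀ : Submodule ℂ V) [FiniteDimensional ℂ W₀] (hW₀ : ∀ w ∈ W₀, D w ∈ W₀) :
    ∃ (S₀ : Finset ℝ) (r₀ : ℝ), 0 ≤ r₀ ∧ (∀ x ∈ S₀, |x| ≤ r₀) ∧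
      ∀ w ∈ W₀, aeval D (Lagrange.nodal S₀ fun x : ℝ => (x : ℂ) * Complex.I) w = 0 := by
  classical
  letI := hB.nacg
  letI := hB.ips
  -- `T := −i D|_{W₀}` is symmetric on the finite-dimensional inner product space `W₀`
  let T : W₀ →ₗ[ℂ] W₀ := (-Complex.I) • D.restrict hW₀
  have hT : T.IsSymmetric := by
    intro x y
    change @inner ℂ V hB.ips.toInner ((T x : W₀) : V) (y : V) = @inner ℂ V hB.ips.toInner (x : V) ((T y : W₀) : V)
    rw [hB.inner_eq, hB.inner_eq]
    change B ((-Complex.I) • D (x : V)) (y : V) = B (x : V) ((-Complex.I) • D (y : V))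
    rw [LinearMap.map_smulₛₗ₂, LinearMap.map_smul, hD, smul_eq_mul, smul_eq_mul, map_neg, Complex.conj_I, neg_neg]
    ring
  set n := Module.finrank ℂ W₀ with hn
  let ev : Fin n → ℝ := hT.eigenvalues hn.symm
  let b := hT.eigenvectorBasis hn.symm
  -- `D (b i) = (i ev_i) • b i`
  have hDb : ∀ i, D ((b i : W₀) : V) = ((ev i : ℂ) * Complex.I) • ((b i : W₀) : V) := by
    intro i
    have h1 : T (b i) = (ev i : ℂ) • b i := hT.apply_eigenvectorBasis hn.symm i
    have h2 : ((T (b i) : W₀) : V) = (-Complex.I) • D ((b i : W₀) : V) := rfl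
    have h3 : (-Complex.I) • D ((b i : W₀) : V) = (ev i : ℂ) • ((b i : W₀) : V) := by
      rw [← h2, h1, Submodule.coe_smul]
    have h4 := congrArg (fun z => Complex.I • z) h3
    simp only [smul_smul] at h4
    rw [show Complex.I * -Complex.I = 1 by rw [mul_neg, Complex.I_mul_I, neg_neg], one_smul] at h4
    rw [h4, mul_comm]
  refine ⟨Finset.univ.image ev, ∑ i, |ev i|, Finset.sum_nonneg fun i _ => abs_nonneg _, ?_, ?_⟩
  · intro x hx
    rw [Finset.mem_image] at hx
    obtain ⟨i, -, rfl⟩ := hx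
    exact Finset.single_le_sum (f := fun i => |ev i|) (fun i _ => abs_nonneg _) (Finset.mem_univ i)
  · -- every basis vector is killed by its own factor, hence by the product; extend linearly
    have hbasis : ∀ i, aeval D (Lagrange.nodal (Finset.univ.image ev) fun x : ℝ => (x : ℂ) * Complex.I) ((b i : W₀) : V) = 0 := by
      intro i
      have hi : ev i ∈ Finset.univ.image ev := Finset.mem_image_of_mem ev (Finset.mem_univ i)
      rw [Lagrange.nodal_eq_mul_nodal_erase hi, mul_comm, map_mul, Module.End.mul_apply, map_sub, aeval_X, aeval_C,
        LinearMap.sub_apply, Module.algebraMap_end_apply, hDb i, sub_self, map_zero]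
    intro w hw
    have hrepr : (w : V) = ∑ i, (b.repr ⟨w, hw⟩ i) • ((b i : W₀) : V) := by
      have h := b.sum_repr ⟨w, hw⟩
      have h' := congrArg (fun z : W₀ => (z : V)) h
      simp only [Submodule.coe_sum, Submodule.coe_smul] at h'
      exact h'.symm
    rw [hrepr, map_sum]
    exact Finset.sum_eq_zero fun i _ => by rw [map_smul, hbasis i, smul_zero]

end Literature.NumberTheory.Automorphic

end
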